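import Literature.NumberTheory.Transcendental.PadicSmallJetsSchwarz
import Mathlib.Analysis.Calculus.FDeriv.Analytic
import Mathlib.Analysis.Calculus.IteratedDeriv.Defs
import Mathlib.Analysis.Analytic.OfScalars
import HarnessLib

/-!
# Jets of a power series with weighted coefficient bounds = Taylor coefficients = derivatives / k!

Sequel to `PadicNewtonInterpolation.lean` / `PadicSmallJetsSchwarz.lean` (definitions and
proved theorems; no named fact). For `G_b(z) = ∑ bₙ zⁿ` with `‖bₙ‖ ρⁿ ≤ B` over a complete
ultrametric field and a point `‖a‖ ≤ r < ρ`, the **jets** used by the small-jets Schwarz lemma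
`PadicNewton.norm_tsum_le_max_of_small_jets`,
`jet a b k = G_{ddList (replicate k a) b}(a)`, are the Taylor coefficients of `G_b` at `a`
(`hasSum_jet`: `G_b(z) = ∑ₖ jet_k (z − a)ᵏ` on the disc), hence `G_b` has the power series
`ofScalars (jet a b)` at `a` (`hasFPowerSeriesOnBall_tsum`) and
**`iteratedDeriv k G_b a = k! · jet a b k`** (`iteratedDeriv_tsum_eq_factorial_mul_jet`, via
Mathlib's `HasFPowerSeriesOnBall.factorial_smul`). Consequently small DERIVATIVES give small jets
up to the factor `‖1/k!‖` (`norm_jet_le_of_norm_iteratedDeriv_le`) — the interface between the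
differential equations of an auxiliary function (bounds on `f^{(k)}(a)`) and the interpolation
lemma (bounds on jets).

## References
* A. M. Robert, *A Course in p-adic Analysis*, GTM 198 (2000), Ch. 6 §§1–2.
* Kunrui Yu, *Linear forms in p-adic logarithms II*, Compositio Math. 74 (1990), §1.2.
-/

noncomputable section

open Filter Topology IsUltrametricDist Finset FormalMultilinearSeries
open scoped Nat ENNReal

namespace Literature.NumberTheory.Transcendental

namespace PadicNewton

variable {K : Type*} [NontriviallyNormedField K] [IsUltrametricDist K] [CompleteSpace K]

/-- **The `k`-th jet** of `G_b` at `a`: `G_{ddList (replicate k a) b}(a)` (`= G_b^{(k)}(a)/k!`).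
[cite: Yu1990, Lemma 1.2] -/
def jet (a : K) (b : ℕ → K) (k : ℕ) : K := ∑' n, ddList (List.replicate k a) b n * a ^ n

omit [CompleteSpace K] in
/-- **Size of the jets**: `‖jet a b k‖ ≤ B/ρᵏ` for `‖a‖ ≤ r ≤ ρ`. [cite: Yu1990, Lemma 1.2] -/
theorem norm_jet_le {ρ B r : ℝ} (hρ : 0 < ρ) (hr : r ≤ ρ) {b : ℕ → K} (hb : WtBdd ρ B b) {a : K}
    (ha : ‖a‖ ≤ r) (k : ℕ) : ‖jet a b k‖ ≤ B / ρ ^ k := by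
  have h := wtBdd_ddList hρ hr (List.replicate k a) hb (fun x hx => by
    rw [List.eq_of_mem_replicate hx]; exact ha)
  rw [List.length_replicate] at h
  exact h.norm_tsum_le hρ hr ha

/-- **Taylor expansion**: `G_b(z) = ∑ₖ jet_k (z − a)ᵏ` for `‖a‖, ‖z‖ ≤ r < ρ` (the remainder
`(z−a)^N G_{ddList…}(z)` of `tsum_eq_taylor` has norm `≤ (r/ρ)^N B → 0`).
[cite: Robert2000PadicAnalysis, Ch. 6 §§1–2] -/
theorem hasSum_jet {ρ B r : ℝ} (hρ : 0 < ρ) (hr : r < ρ) {b : ℕ → K} (hb : WtBdd ρ B b) {a : K}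
    (ha : ‖a‖ ≤ r) {z : K} (hz : ‖z‖ ≤ r) :
    HasSum (fun k => jet a b k * (z - a) ^ k) (∑' n, b n * z ^ n) := by
  have hr0 : 0 ≤ r := (norm_nonneg _).trans ha
  have hq0 : 0 ≤ r / ρ := div_nonneg hr0 hρ.le
  have hq1 : r / ρ < 1 := (div_lt_one hρ).mpr hr
  have hza : ‖z - a‖ ≤ r := by
    rw [sub_eq_add_neg]
    exact (norm_add_le_max _ _).trans (max_le hz (by rw [norm_neg]; exact ha))
  -- the terms are bounded by a geometric series
  have hterm : ∀ k, ‖jet a b k * (z - a) ^ k‖ ≤ B * (r / ρ) ^ k := by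
    intro k
    rw [norm_mul, norm_pow, div_pow]
    calc ‖jet a b k‖ * ‖z - a‖ ^ k ≤ B / ρ ^ k * r ^ k :=
          mul_le_mul (norm_jet_le hρ hr.le hb ha k) (pow_le_pow_left₀ (norm_nonneg _) hza k)
            (by positivity) (div_nonneg hb.nonneg (by positivity))
      _ = B * (r ^ k / ρ ^ k) := by ring
  have hsn : Summable fun k => ‖jet a b k * (z - a) ^ k‖ :=
    Summable.of_nonneg_of_le (fun _ => norm_nonneg _) hterm
      ((summable_geometric_of_lt_one hq0 hq1).mul_left B)
  rw [hasSum_iff_tendsto_nat_of_summable_norm hsn]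
  -- partial sums = G(z) − (z−a)^N · remainder
  have hpartial : ∀ N, ∑ k ∈ range N, jet a b k * (z - a) ^ k =
      (∑' n, b n * z ^ n) - (z - a) ^ N * ∑' n, ddList (List.replicate N a) b n * z ^ n := by
    intro N
    rw [tsum_eq_taylor hρ hr hb ha hz N]
    simp only [jet]
    ring
  simp_rw [hpartial]
  rw [show 𝓝 (∑' n, b n * z ^ n) = 𝓝 ((∑' n, b n * z ^ n) - 0) by rw [sub_zero]]
  refine tendsto_const_nhds.sub ?_
  have hgeo : Tendsto (fun N : ℕ => B * (r / ρ) ^ N) atTop (𝓝 0) := by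
    simpa using (tendsto_pow_atTop_nhds_zero_of_lt_one hq0 hq1).const_mul B
  refine squeeze_zero_norm (fun N => ?_) hgeo
  have hR := wtBdd_ddList hρ hr.le (List.replicate N a) hb (fun x hx => by
    rw [List.eq_of_mem_replicate hx]; exact ha)
  rw [List.length_replicate] at hR
  rw [norm_mul, norm_pow, div_pow]
  calc ‖z - a‖ ^ N * ‖∑' n, ddList (List.replicate N a) b n * z ^ n‖
      ≤ r ^ N * (B / ρ ^ N) :=
        mul_le_mul (pow_le_pow_left₀ (norm_nonneg _) hza N) (hR.norm_tsum_le hρ hr.le hz)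
          (norm_nonneg _) (by positivity)
    _ = B * (r ^ N / ρ ^ N) := by ring

/-- **`G_b` has the power series `∑ jet_k yᵏ` at `a`** on the ball of radius `r`
(`‖a‖ ≤ r < ρ`, `0 < r`). [cite: Robert2000PadicAnalysis, Ch. 6 §§1–2] -/
theorem hasFPowerSeriesOnBall_tsum {ρ B r : ℝ} (hρ : 0 < ρ) (hr : r < ρ) (hr0 : 0 < r) {b : ℕ → K}
    (hb : WtBdd ρ B b) {a : K} (ha : ‖a‖ ≤ r) :
    HasFPowerSeriesOnBall (fun z => ∑' n, b n * z ^ n) (ofScalars K (jet a b)) a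
      (ENNReal.ofReal r) := by
  refine ⟨?_, by simpa using hr0, fun {y} hy => ?_⟩
  · -- radius
    refine le_radius_of_bound _ B fun k => ?_
    have hk := norm_jet_le hρ hr.le hb ha k
    rw [Real.coe_toNNReal _ hr0.le]
    calc ‖ofScalars K (jet a b) k‖ * r ^ k ≤ ‖jet a b k‖ * r ^ k := by
          refine mul_le_mul_of_nonneg_right ?_ (by positivity)
          rw [ofScalars_norm_eq_mul]
          refine mul_le_of_le_one_right (norm_nonneg _) ?_
          exact ContinuousMultilinearMap.norm_mkPiAlgebraFin_le.trans (by simp)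
      _ ≤ B / ρ ^ k * r ^ k := mul_le_mul_of_nonneg_right hk (by positivity)
      _ = B * (r / ρ) ^ k := by rw [div_pow]; ring
      _ ≤ B * 1 := by
          refine mul_le_mul_of_nonneg_left ?_ hb.nonneg
          exact pow_le_one₀ (div_nonneg hr0.le hρ.le) ((div_le_one hρ).mpr hr.le)
      _ = B := mul_one _
  · -- the sum
    have hy' : ‖y‖ ≤ r := by
      rw [Metric.mem_eball, edist_zero_right, enorm_eq_nnnorm] at hy
      have : (‖y‖₊ : ℝ) < r := by
        have h := ENNReal.coe_lt_coe.mp (hy.trans_le (le_of_eq (ENNReal.ofReal_eq_coe_nnreal hr0.le)))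
        exact_mod_cast h
      exact this.le
    have haz : ‖a + y‖ ≤ r := (norm_add_le_max _ _).trans (max_le ha hy')
    have h := hasSum_jet hρ hr hb ha haz
    simp only [add_sub_cancel_left] at h
    rw [ofScalars_apply_eq']
    simpa [smul_eq_mul] using h

/-- **Derivatives are factorials times jets**: `G_b^{(k)}(a) = k! · jet a b k` for
`‖a‖ ≤ r < ρ`. [cite: Robert2000PadicAnalysis, Ch. 6 §2] -/
theorem iteratedDeriv_tsum_eq_factorial_mul_jet {ρ B r : ℝ} (hρ : 0 < ρ) (hr : r < ρ) (hr0 : 0 < r)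
    {b : ℕ → K} (hb : WtBdd ρ B b) {a : K} (ha : ‖a‖ ≤ r) (k : ℕ) :
    iteratedDeriv k (fun z => ∑' n, b n * z ^ n) a = (k ! : K) * jet a b k := by
  have h := (hasFPowerSeriesOnBall_tsum hρ hr hr0 hb ha).factorial_smul 1 k
  rw [iteratedDeriv_eq_iteratedFDeriv, ← h, ofScalars_apply_eq, one_pow, smul_eq_mul, mul_one,
    nsmul_eq_mul]

/-- **Small derivatives give small jets**: `‖jet a b k‖ ≤ ‖(k!)⁻¹‖ · ‖G_b^{(k)}(a)‖`.
[cite: Yu1990, Lemma 1.2] -/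
theorem norm_jet_le_norm_iteratedDeriv [CharZero K] {ρ B r : ℝ} (hρ : 0 < ρ) (hr : r < ρ)
    (hr0 : 0 < r)
    {b : ℕ → K} (hb : WtBdd ρ B b) {a : K} (ha : ‖a‖ ≤ r) (k : ℕ) :
    ‖jet a b k‖ ≤ ‖((k ! : ℕ) : K)⁻¹‖ * ‖iteratedDeriv k (fun z => ∑' n, b n * z ^ n) a‖ := by
  have hk : ((k ! : ℕ) : K) ≠ 0 := Nat.cast_ne_zero.mpr k.factorial_ne_zero
  rw [iteratedDeriv_tsum_eq_factorial_mul_jet hρ hr hr0 hb ha k, ← norm_mul, ← mul_assoc,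
    show ((k ! : K)) = ((k ! : ℕ) : K) by norm_cast, inv_mul_cancel₀ hk, one_mul]

end PadicNewton

end Literature.NumberTheory.Transcendental

end
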